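import Summits.HodgeConjecture.HodgeConjecture.Theorems.R90S3TransportPrincipalSeries
import Literature.NumberTheory.Automorphic.SmoothCharacterOfCharacter
import Literature.NumberTheory.Automorphic.TorusCharacterLocalComponents
import HarnessLib

/-!
# R90 · S3 · FILE G bricks G3a + G3b — the (13.8.5) TYPE-2 and TYPE-3 data of `H_v` are transported along a ground-field change

R90-TF SLAB, section S3 (Rogawski Ch. 13.2 «Endo-H»), dealer R90-C12-plan (g2) «BUNDLE 1»; seat K2E3-p36 (g3); crux H413 =
`stmt-HodgeConjecture-24833`, route `HCCMUnconditional`, lane `--supports … --as helper` (count-neutral).  PAYS, IN NAME-SHAPE (statements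
= the socket bodies of `Cruxes/H413/Lines/R90_S3_LocalTransportWaveG.lean` ED. 3 (tree sha16 7e1bdc0be15c4802; byte-identical to ED. 1 for these
sockets) VERBATIM, binders included; G ED. 4's pen closes each socket by `exact`):
* G3a `stub_R90_S3_transport_lengthTwo` (:228) ← `hLengthTwoLabels_transport`: if `σ ∈ Irr(H_v)` is a constituent label of a length-two
  `i_H(χ₂ ⊠ χ₁)` with one-dimensional partner `⟦ℂ_Ξ⟧` (★ `HLengthTwoLabels`), then `σ ∘ e_H⁻¹` is such a label for
  `(χ₂′, χ₁′, Ξ′) := (χ₂ ∘ e₂⁻¹|_T′, χ₁ ∘ e₁⁻¹, Ξ ∘ e_H⁻¹)` on the primed side;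
* G3b `stub_R90_S3_transport_irredPS` (:272) ← `irredPS_transport`: if `σ` is a constituent of an IRREDUCIBLE `i_H(χ₂ ⊠ χ₁)` (`χ₁` smooth),
  then `σ ∘ e_H⁻¹` is a constituent of the irreducible `i_H(χ₂′ ⊠ χ₁′)` (`χ₁′` smooth).
PROOF = the kit ★ `R90S3TransportPrincipalSeries` (`i_H(χ₂ ⊠ χ₁) ≅ i_H(χ₂′ ⊠ χ₁′) ∘ e_H`: constituents
`comap_symm_isConstituentOf_cmPrincipalSeriesH_iff`, irreducibility `isIrreducible_cmPrincipalSeriesH_transport`; the torus restriction of `e₂⁻¹`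
from `transport_mem_torusU_iff`) + `⟦ℂ_Ξ⟧ ∘ e = ⟦ℂ_{Ξ ∘ e}⟧` (`comap_mk_ofChar`: the identity of `ℂ` intertwines) + ★ `IrrClass.comap_injective`
∕ `comap_symm_comap`.  One direction each (the converse is the socket at the reversed datum).  The dead binders of the socket frame
(`hc hc' hΦσ μ μ' hΦμ he₁`, AUDIT S3#48) are carried and unused.  ★-ONLY IMPORTS; theorems only (no `def`, no instance, no notation, no `sorry`).

HONEST LABEL: HC_CM is proved only modulo the 7 printed citations (2 remaining named inputs: hLiu418 = stmt-HodgeConjecture-24832,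
h413 = stmt-HodgeConjecture-24833) until rung 0 closes; pure transport of structure — NOT a print input; pays G3a∕G3b only when ★ AND the next
G edition plugs them and is BUILT; G is off the rung-0 path except via S10's file U.  REL ≠ ★ ≠ BUILT.

## References
* [Rogawski1990] J. D. Rogawski, *Automorphic Representations of Unitary Groups in Three Variables*, Ann. of Math. Stud. 123 (1990), §12.1
  pp. 171–172 (`i_H(χ)`, `JH(i_H(χ)) = {ξ, St_H(ξ)}`), §13.8 (13.8.5) p. 219 (the four types of `ρ`), §14.2 p. 232 («`G′_v ≃ G_v`»).
* [BernsteinZelevinsky1977] I. N. Bernstein, A. V. Zelevinsky, Ann. Sci. ÉNS 10 (1977), §2.3 · [BushnellHenniart2006] §1.1, §1.5, §9.1.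
-/

set_option autoImplicit false
-- the mandated namespace repeats the single-problem summit's segment (`HodgeConjecture.HodgeConjecture`)
set_option linter.dupNamespace false

noncomputable section

open NumberField IsDedekindDomain
open scoped Matrix MatrixGroups
open Literature.NumberTheory.Automorphic Literature.NumberTheory.Automorphic.UnitaryGroup Literature.NumberTheory.GaloisRepresentations

namespace Summit.HodgeConjecture.HodgeConjecture.R90.S3

/-! ## §0 `⟦ℂ_Ξ⟧ ∘ e = ⟦ℂ_{Ξ ∘ e}⟧` and open kernels under `e⁻¹` -/

/-- **The class of a character pulls back to the class of the composed character**: for `e : G′ ≃ₜ* G` and smooth characters `Ξ₁` of `G`,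
`Ξ₂` of `G′` with `Ξ₂ = Ξ₁ ∘ e`, `⟦ℂ_{Ξ₁}⟧ ∘ e = ⟦ℂ_{Ξ₂}⟧` in `Irr(G′)` (★ `IrrClass.comap_mk`; the identity of `ℂ` intertwines, ★
`SmoothIrrep.ofChar_ρ_apply`). [cite: BushnellHenniart2006, §1.5] [cite: Rogawski1990, §12.1 p. 171] -/
theorem comap_mk_ofChar {G G' : Type} [Group G] [TopologicalSpace G] [IsTopologicalGroup G] [Group G'] [TopologicalSpace G']
    [IsTopologicalGroup G'] (e : G' ≃ₜ* G)
    (Ξ₁ : G →* ℂˣ) (h₁ : IsOpen ((Ξ₁.ker : Subgroup G) : Set G)) (Ξ₂ : G' →* ℂˣ) (h₂ : IsOpen ((Ξ₂.ker : Subgroup G') : Set G'))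
    (h : ∀ g', Ξ₂ g' = Ξ₁ (e g')) :
    IrrClass.comap e (IrrClass.mk (SmoothIrrep.ofChar Ξ₁ h₁)) = IrrClass.mk (SmoothIrrep.ofChar Ξ₂ h₂) := by
  rw [IrrClass.comap_mk]
  refine IrrClass.mk_eq_mk_of_equiv (Representation.Equiv.mk (LinearEquiv.refl ℂ ℂ) fun g' => LinearMap.ext fun (z : ℂ) => ?_)
  change (SmoothIrrep.ofChar Ξ₁ h₁).ρ (e g') z = (SmoothIrrep.ofChar Ξ₂ h₂).ρ g' z
  rw [SmoothIrrep.ofChar_ρ_apply, SmoothIrrep.ofChar_ρ_apply, h g']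

/-- The kernel of `χ ∘ e⁻¹` is open when the kernel of `χ` is (`e⁻¹` continuous). [cite: BushnellHenniart2006, §1.5] -/
theorem isOpen_ker_comp_symm {G G' : Type} [Group G] [TopologicalSpace G] [Group G'] [TopologicalSpace G'] (e : G ≃ₜ* G')
    (χ : G →* ℂˣ) (hχ : IsOpen ((χ.ker : Subgroup G) : Set G)) :
    IsOpen (((χ.comp (e.symm : G' →* G)).ker : Subgroup G') : Set G') := by
  rw [← MonoidHom.comap_ker, Subgroup.coe_comap]
  exact hχ.preimage e.symm.continuous

section Bricks

variable (L : Type) [Field L] [NumberField L] [IsCMField L] (v : HeightOneSpectrum (𝓞 ↥(maximalRealSubfield L)))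

/-! ## §1 G3a — the TYPE-2 datum `(χ₂, χ₁, Ξ; σ)` of ★ `HLengthTwoLabels` is transported -/

set_option maxHeartbeats 4000000 in
/-- **G3a `stub_R90_S3_transport_lengthTwo` IN NAME-SHAPE — the (13.8.5) TYPE-2 datum is transported.**  If `σ ∈ Irr(H_v)` and `⟦ℂ_Ξ⟧`
are the two constituent labels of a length-two `i_H(χ₂ ⊠ χ₁)` (★ `HLengthTwoLabels L v χ₂ χ₁ ⟦ℂ_Ξ⟧ σ`), then along the ground-field change
`(Φ, e₂, e₁, e_H)` the class `σ ∘ e_H⁻¹ = IrrClass.comap eH.symm σ` is such a label on the primed side, for the witnesses `χ₂′ := χ₂ ∘ e₂⁻¹|_T′`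
(kit `transport_mem_torusU_iff`), `χ₁′ := χ₁ ∘ e₁⁻¹`, `Ξ′ := Ξ ∘ e_H⁻¹` (open kernel by continuity of `e_H⁻¹`).  WHY: `i_H(χ₂ ⊠ χ₁) ≅
i_H(χ₂′ ⊠ χ₁′) ∘ e_H` (kit `comap_symm_isConstituentOf_cmPrincipalSeriesH_iff`), so `JH(i_H(χ₂′ ⊠ χ₁′)) = (e_H)_* JH(i_H(χ₂ ⊠ χ₁)) =
{⟦ℂ_Ξ⟧ ∘ e_H⁻¹, σ ∘ e_H⁻¹} = {⟦ℂ_{Ξ′}⟧, σ ∘ e_H⁻¹}` (`comap_mk_ofChar`), two distinct classes (`comap` is injective).  Statement = socket G3a of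
`Lines/R90_S3_LocalTransportWaveG.lean` :228 VERBATIM (dead frame binders `hc hc' hΦσ μ μ' hΦμ he₁` carried); NOT a print input.
[cite: Rogawski1990, §12.1 pp. 171–172; §13.8 p. 219; §14.2 p. 232] [cite: BernsteinZelevinsky1977, §2.3] -/
theorem hLengthTwoLabels_transport
    (L' : Type) [Field L'] [NumberField L'] [IsCMField L'] (v' : HeightOneSpectrum (𝓞 ↥(maximalRealSubfield L')))
    (Φ : UnitaryGroup.LocalRing L v ≃+* UnitaryGroup.LocalRing L' v') (_hc : Continuous Φ) (_hc' : Continuous Φ.symm)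
    (_hΦσ : ∀ x, Φ ((conjLocal L (IsCMField.complexConj L) v) x) = (conjLocal L' (IsCMField.complexConj L') v') (Φ x))
    (μ : HeckeCharacter L) (μ' : HeckeCharacter L')
    (_hΦμ : ∀ u : (UnitaryGroup.LocalRing L v)ˣ,
      μ'.semilocalComponent L' v' (Units.map (Φ : UnitaryGroup.LocalRing L v →+* UnitaryGroup.LocalRing L' v').toMonoidHom u) = μ.semilocalComponent L v u)
    (e₂ : (UnitaryGroup.cmDatum L 2 (Matrix.of fun i j : Fin 2 => if i.val + j.val + 1 = 2 then (1 : L) else 0)).Local v ≃ₜ*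
      (UnitaryGroup.cmDatum L' 2 (Matrix.of fun i j : Fin 2 => if i.val + j.val + 1 = 2 then (1 : L') else 0)).Local v')
    (he₂ : ∀ g, ((e₂ g).val : GL (Fin 2) (UnitaryGroup.LocalRing L' v')) = Matrix.GeneralLinearGroup.map (Φ : UnitaryGroup.LocalRing L v →+* UnitaryGroup.LocalRing L' v') (g.val : GL (Fin 2) (UnitaryGroup.LocalRing L v)))
    (e₁ : (UnitaryGroup.cmDatum L 1 (Matrix.of fun i j : Fin 1 => if i.val + j.val + 1 = 1 then (1 : L) else 0)).Local v ≃ₜ*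
      (UnitaryGroup.cmDatum L' 1 (Matrix.of fun i j : Fin 1 => if i.val + j.val + 1 = 1 then (1 : L') else 0)).Local v')
    (_he₁ : ∀ g, ((e₁ g).val : GL (Fin 1) (UnitaryGroup.LocalRing L' v')) = Matrix.GeneralLinearGroup.map (Φ : UnitaryGroup.LocalRing L v →+* UnitaryGroup.LocalRing L' v') (g.val : GL (Fin 1) (UnitaryGroup.LocalRing L v)))
    (eH : ((UnitaryGroup.cmDatum L 2 (Matrix.of fun i j : Fin 2 => if i.val + j.val + 1 = 2 then (1 : L) else 0)).Local v ×
      (UnitaryGroup.cmDatum L 1 (Matrix.of fun i j : Fin 1 => if i.val + j.val + 1 = 1 then (1 : L) else 0)).Local v) ≃ₜ*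
      ((UnitaryGroup.cmDatum L' 2 (Matrix.of fun i j : Fin 2 => if i.val + j.val + 1 = 2 then (1 : L') else 0)).Local v' ×
      (UnitaryGroup.cmDatum L' 1 (Matrix.of fun i j : Fin 1 => if i.val + j.val + 1 = 1 then (1 : L') else 0)).Local v'))
    (heH : ∀ h, eH h = (e₂ h.1, e₁ h.2))
    (σ : IrrClass ((UnitaryGroup.cmDatum L 2 (Matrix.of fun i j : Fin 2 => if i.val + j.val + 1 = 2 then (1 : L) else 0)).Local v ×
      (UnitaryGroup.cmDatum L 1 (Matrix.of fun i j : Fin 1 => if i.val + j.val + 1 = 1 then (1 : L) else 0)).Local v))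
    (χ₂ : ↥(torusU (conjLocal L (IsCMField.complexConj L) v) (cmLocalForm L 2 v)) →* ℂˣ)
    (χ₁ : (UnitaryGroup.cmDatum L 1 (Matrix.of fun i j : Fin 1 => if i.val + j.val + 1 = 1 then (1 : L) else 0)).Local v →* ℂˣ)
    (Ξ : ((UnitaryGroup.cmDatum L 2 (Matrix.of fun i j : Fin 2 => if i.val + j.val + 1 = 2 then (1 : L) else 0)).Local v ×
      (UnitaryGroup.cmDatum L 1 (Matrix.of fun i j : Fin 1 => if i.val + j.val + 1 = 1 then (1 : L) else 0)).Local v) →* ℂˣ)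
    (hΞ : IsOpen ((Ξ.ker : Subgroup ((UnitaryGroup.cmDatum L 2 (Matrix.of fun i j : Fin 2 => if i.val + j.val + 1 = 2 then (1 : L) else 0)).Local v ×
      (UnitaryGroup.cmDatum L 1 (Matrix.of fun i j : Fin 1 => if i.val + j.val + 1 = 1 then (1 : L) else 0)).Local v)) :
      Set ((UnitaryGroup.cmDatum L 2 (Matrix.of fun i j : Fin 2 => if i.val + j.val + 1 = 2 then (1 : L) else 0)).Local v ×
      (UnitaryGroup.cmDatum L 1 (Matrix.of fun i j : Fin 1 => if i.val + j.val + 1 = 1 then (1 : L) else 0)).Local v)))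
    (hT2 : HLengthTwoLabels L v χ₂ χ₁ (IrrClass.mk (SmoothIrrep.ofChar Ξ hΞ)) σ) :
    ∃ (χ₂' : ↥(torusU (conjLocal L' (IsCMField.complexConj L') v') (cmLocalForm L' 2 v')) →* ℂˣ)
      (χ₁' : (UnitaryGroup.cmDatum L' 1 (Matrix.of fun i j : Fin 1 => if i.val + j.val + 1 = 1 then (1 : L') else 0)).Local v' →* ℂˣ)
      (Ξ' : ((UnitaryGroup.cmDatum L' 2 (Matrix.of fun i j : Fin 2 => if i.val + j.val + 1 = 2 then (1 : L') else 0)).Local v' ×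
      (UnitaryGroup.cmDatum L' 1 (Matrix.of fun i j : Fin 1 => if i.val + j.val + 1 = 1 then (1 : L') else 0)).Local v') →* ℂˣ)
      (hΞ' : IsOpen ((Ξ'.ker : Subgroup ((UnitaryGroup.cmDatum L' 2 (Matrix.of fun i j : Fin 2 => if i.val + j.val + 1 = 2 then (1 : L') else 0)).Local v' ×
      (UnitaryGroup.cmDatum L' 1 (Matrix.of fun i j : Fin 1 => if i.val + j.val + 1 = 1 then (1 : L') else 0)).Local v')) :
        Set ((UnitaryGroup.cmDatum L' 2 (Matrix.of fun i j : Fin 2 => if i.val + j.val + 1 = 2 then (1 : L') else 0)).Local v' ×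
      (UnitaryGroup.cmDatum L' 1 (Matrix.of fun i j : Fin 1 => if i.val + j.val + 1 = 1 then (1 : L') else 0)).Local v'))),
      HLengthTwoLabels L' v' χ₂' χ₁' (IrrClass.mk (SmoothIrrep.ofChar Ξ' hΞ')) (IrrClass.comap eH.symm σ) := by
  -- (0) the torus restriction of `e₂⁻¹` (kit §1 at the reversed datum; the carrier spelling is bridged once per use) and `χ₂′ := χ₂ ∘ e₂⁻¹|_T′`
  have he₂' := transport_symm_val L v L' v' Φ e₂ he₂
  have hT : ∀ t' : ↥(unitaryGroupOfForm (conjLocal L' (IsCMField.complexConj L') v') (cmLocalForm L' 2 v')),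
      t' ∈ torusU (conjLocal L' (IsCMField.complexConj L') v') (cmLocalForm L' 2 v') →
        e₂.symm t' ∈ torusU (conjLocal L (IsCMField.complexConj L) v) (cmLocalForm L 2 v) := fun t' ht' =>
    (transport_mem_torusU_iff L' v' L v Φ.symm e₂.symm he₂' t').2 ht'
  let τ : ↥(torusU (conjLocal L' (IsCMField.complexConj L') v') (cmLocalForm L' 2 v')) →* ↥(torusU (conjLocal L (IsCMField.complexConj L) v) (cmLocalForm L 2 v)) :=
    { toFun := fun t' => ⟨e₂.symm (t' : ↥(unitaryGroupOfForm (conjLocal L' (IsCMField.complexConj L') v') (cmLocalForm L' 2 v'))), hT _ t'.2⟩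
      map_one' := Subtype.ext (map_one e₂.symm)
      map_mul' := fun a b => Subtype.ext (map_mul e₂.symm _ _) }
  have hτ : ∀ (t : ↥(torusU (conjLocal L (IsCMField.complexConj L) v) (cmLocalForm L 2 v)))
      (ht : e₂ (t : ↥(unitaryGroupOfForm (conjLocal L (IsCMField.complexConj L) v) (cmLocalForm L 2 v))) ∈
        torusU (conjLocal L' (IsCMField.complexConj L') v') (cmLocalForm L' 2 v')),
      (χ₂.comp τ) ⟨e₂ (t : ↥(unitaryGroupOfForm (conjLocal L (IsCMField.complexConj L) v) (cmLocalForm L 2 v))), ht⟩ = χ₂ t := by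
    intro t ht
    show χ₂ (τ ⟨e₂ (t : ↥(unitaryGroupOfForm (conjLocal L (IsCMField.complexConj L) v) (cmLocalForm L 2 v))), ht⟩) = χ₂ t
    congr 1
    exact Subtype.ext (e₂.symm_apply_apply _)
  have hχ₁' : ∀ g, (χ₁.comp (e₁.symm : (UnitaryGroup.cmDatum L' 1 (Matrix.of fun i j : Fin 1 => if i.val + j.val + 1 = 1 then (1 : L') else 0)).Local v' →* (UnitaryGroup.cmDatum L 1 (Matrix.of fun i j : Fin 1 => if i.val + j.val + 1 = 1 then (1 : L) else 0)).Local v)) (e₁ g) = χ₁ g := fun g => by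
    change χ₁ (e₁.symm (e₁ g)) = χ₁ g; rw [ContinuousMulEquiv.symm_apply_apply]
  have hΞ' := isOpen_ker_comp_symm eH Ξ hΞ
  refine ⟨χ₂.comp τ, χ₁.comp (e₁.symm : (UnitaryGroup.cmDatum L' 1 (Matrix.of fun i j : Fin 1 => if i.val + j.val + 1 = 1 then (1 : L') else 0)).Local v' →* (UnitaryGroup.cmDatum L 1 (Matrix.of fun i j : Fin 1 => if i.val + j.val + 1 = 1 then (1 : L) else 0)).Local v),
    Ξ.comp (eH.symm : ((UnitaryGroup.cmDatum L' 2 (Matrix.of fun i j : Fin 2 => if i.val + j.val + 1 = 2 then (1 : L') else 0)).Local v' × (UnitaryGroup.cmDatum L' 1 (Matrix.of fun i j : Fin 1 => if i.val + j.val + 1 = 1 then (1 : L') else 0)).Local v') →* ((UnitaryGroup.cmDatum L 2 (Matrix.of fun i j : Fin 2 => if i.val + j.val + 1 = 2 then (1 : L) else 0)).Local v × (UnitaryGroup.cmDatum L 1 (Matrix.of fun i j : Fin 1 => if i.val + j.val + 1 = 1 then (1 : L) else 0)).Local v)), hΞ', ?_, ?_⟩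
  · -- the two labels stay distinct: `comap eH.symm` is injective and `⟦ℂ_Ξ⟧ ∘ e_H = ⟦ℂ_{Ξ′}⟧`
    intro habs
    apply hT2.1
    have h1 : IrrClass.comap eH.symm (IrrClass.mk (SmoothIrrep.ofChar Ξ hΞ)) = IrrClass.mk (SmoothIrrep.ofChar _ hΞ') :=
      comap_mk_ofChar eH.symm Ξ hΞ _ hΞ' fun _ => rfl
    exact IrrClass.comap_injective eH.symm (habs.trans h1.symm)
  · -- `JH(i_H(χ₂′ ⊠ χ₁′)) = (e_H)_* {⟦ℂ_Ξ⟧, σ}`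
    intro c'
    have hc' : IrrClass.comap eH.symm (IrrClass.comap eH c') = c' := IrrClass.comap_symm_comap eH c'
    rw [← hc', comap_symm_isConstituentOf_cmPrincipalSeriesH_iff L v L' v' Φ e₂ he₂ e₁ eH heH χ₂ (χ₂.comp τ) hτ χ₁
      (χ₁.comp (e₁.symm : (UnitaryGroup.cmDatum L' 1 (Matrix.of fun i j : Fin 1 => if i.val + j.val + 1 = 1 then (1 : L') else 0)).Local v' →* (UnitaryGroup.cmDatum L 1 (Matrix.of fun i j : Fin 1 => if i.val + j.val + 1 = 1 then (1 : L) else 0)).Local v)) hχ₁' (IrrClass.comap eH c'),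
      hT2.2 (IrrClass.comap eH c'), ← comap_mk_ofChar eH.symm Ξ hΞ _ hΞ' fun _ => rfl,
      (IrrClass.comap_injective eH.symm).eq_iff, (IrrClass.comap_injective eH.symm).eq_iff]

/-! ## §2 G3b — the TYPE-3 datum (irreducible `i_H(χ₂ ⊠ χ₁)`) is transported -/

set_option maxHeartbeats 4000000 in
/-- **G3b `stub_R90_S3_transport_irredPS` IN NAME-SHAPE — the (13.8.5) TYPE-3 datum is transported.**  If `σ` is a constituent of an
IRREDUCIBLE `i_H(χ₂ ⊠ χ₁)` with `χ₁` smooth, then `σ ∘ e_H⁻¹` is a constituent of `i_H(χ₂′ ⊠ χ₁′)` for `χ₂′ := χ₂ ∘ e₂⁻¹|_T′`,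
`χ₁′ := χ₁ ∘ e₁⁻¹` (smooth: open kernel by continuity), which is irreducible (kit `isIrreducible_cmPrincipalSeriesH_transport`:
`i_H(χ₂ ⊠ χ₁) ≅ i_H(χ₂′ ⊠ χ₁′) ∘ e_H` and ★ `isIrreducible_of_equivariant_equiv`; constituents by kit
`comap_symm_isConstituentOf_cmPrincipalSeriesH_iff`).  Statement = socket G3b of `Lines/R90_S3_LocalTransportWaveG.lean` :272 VERBATIM (dead frame
binders carried); NOT a print input. [cite: Rogawski1990, §12.1 pp. 171–172; §13.8 p. 219; §14.2 p. 232] [cite: BernsteinZelevinsky1977, §2.3] -/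
theorem irredPS_transport
    (L' : Type) [Field L'] [NumberField L'] [IsCMField L'] (v' : HeightOneSpectrum (𝓞 ↥(maximalRealSubfield L')))
    (Φ : UnitaryGroup.LocalRing L v ≃+* UnitaryGroup.LocalRing L' v') (_hc : Continuous Φ) (_hc' : Continuous Φ.symm)
    (_hΦσ : ∀ x, Φ ((conjLocal L (IsCMField.complexConj L) v) x) = (conjLocal L' (IsCMField.complexConj L') v') (Φ x))
    (μ : HeckeCharacter L) (μ' : HeckeCharacter L')
    (_hΦμ : ∀ u : (UnitaryGroup.LocalRing L v)ˣ,
      μ'.semilocalComponent L' v' (Units.map (Φ : UnitaryGroup.LocalRing L v →+* UnitaryGroup.LocalRing L' v').toMonoidHom u) = μ.semilocalComponent L v u)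
    (e₂ : (UnitaryGroup.cmDatum L 2 (Matrix.of fun i j : Fin 2 => if i.val + j.val + 1 = 2 then (1 : L) else 0)).Local v ≃ₜ*
      (UnitaryGroup.cmDatum L' 2 (Matrix.of fun i j : Fin 2 => if i.val + j.val + 1 = 2 then (1 : L') else 0)).Local v')
    (he₂ : ∀ g, ((e₂ g).val : GL (Fin 2) (UnitaryGroup.LocalRing L' v')) = Matrix.GeneralLinearGroup.map (Φ : UnitaryGroup.LocalRing L v →+* UnitaryGroup.LocalRing L' v') (g.val : GL (Fin 2) (UnitaryGroup.LocalRing L v)))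
    (e₁ : (UnitaryGroup.cmDatum L 1 (Matrix.of fun i j : Fin 1 => if i.val + j.val + 1 = 1 then (1 : L) else 0)).Local v ≃ₜ*
      (UnitaryGroup.cmDatum L' 1 (Matrix.of fun i j : Fin 1 => if i.val + j.val + 1 = 1 then (1 : L') else 0)).Local v')
    (_he₁ : ∀ g, ((e₁ g).val : GL (Fin 1) (UnitaryGroup.LocalRing L' v')) = Matrix.GeneralLinearGroup.map (Φ : UnitaryGroup.LocalRing L v →+* UnitaryGroup.LocalRing L' v') (g.val : GL (Fin 1) (UnitaryGroup.LocalRing L v)))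
    (eH : ((UnitaryGroup.cmDatum L 2 (Matrix.of fun i j : Fin 2 => if i.val + j.val + 1 = 2 then (1 : L) else 0)).Local v ×
      (UnitaryGroup.cmDatum L 1 (Matrix.of fun i j : Fin 1 => if i.val + j.val + 1 = 1 then (1 : L) else 0)).Local v) ≃ₜ*
      ((UnitaryGroup.cmDatum L' 2 (Matrix.of fun i j : Fin 2 => if i.val + j.val + 1 = 2 then (1 : L') else 0)).Local v' ×
      (UnitaryGroup.cmDatum L' 1 (Matrix.of fun i j : Fin 1 => if i.val + j.val + 1 = 1 then (1 : L') else 0)).Local v'))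
    (heH : ∀ h, eH h = (e₂ h.1, e₁ h.2))
    (σ : IrrClass ((UnitaryGroup.cmDatum L 2 (Matrix.of fun i j : Fin 2 => if i.val + j.val + 1 = 2 then (1 : L) else 0)).Local v ×
      (UnitaryGroup.cmDatum L 1 (Matrix.of fun i j : Fin 1 => if i.val + j.val + 1 = 1 then (1 : L) else 0)).Local v))
    (χ₂ : ↥(torusU (conjLocal L (IsCMField.complexConj L) v) (cmLocalForm L 2 v)) →* ℂˣ)
    (χ₁ : (UnitaryGroup.cmDatum L 1 (Matrix.of fun i j : Fin 1 => if i.val + j.val + 1 = 1 then (1 : L) else 0)).Local v →* ℂˣ)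
    (hχ₁ : IsOpen ((χ₁.ker : Subgroup ((UnitaryGroup.cmDatum L 1 (Matrix.of fun i j : Fin 1 => if i.val + j.val + 1 = 1 then (1 : L) else 0)).Local v)) : Set ((UnitaryGroup.cmDatum L 1 (Matrix.of fun i j : Fin 1 => if i.val + j.val + 1 = 1 then (1 : L) else 0)).Local v)))
    (hirr : (cmPrincipalSeriesH L v χ₂ χ₁).IsIrreducible) (hσ : σ.IsConstituentOf (cmPrincipalSeriesH L v χ₂ χ₁)) :
    ∃ (χ₂' : ↥(torusU (conjLocal L' (IsCMField.complexConj L') v') (cmLocalForm L' 2 v')) →* ℂˣ)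
      (χ₁' : (UnitaryGroup.cmDatum L' 1 (Matrix.of fun i j : Fin 1 => if i.val + j.val + 1 = 1 then (1 : L') else 0)).Local v' →* ℂˣ),
      IsOpen ((χ₁'.ker : Subgroup ((UnitaryGroup.cmDatum L' 1 (Matrix.of fun i j : Fin 1 => if i.val + j.val + 1 = 1 then (1 : L') else 0)).Local v')) : Set ((UnitaryGroup.cmDatum L' 1 (Matrix.of fun i j : Fin 1 => if i.val + j.val + 1 = 1 then (1 : L') else 0)).Local v')) ∧
      (cmPrincipalSeriesH L' v' χ₂' χ₁').IsIrreducible ∧ (IrrClass.comap eH.symm σ).IsConstituentOf (cmPrincipalSeriesH L' v' χ₂' χ₁') := by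
  -- (0) the torus restriction of `e₂⁻¹` (kit §1 at the reversed datum; the carrier spelling is bridged once per use) and `χ₂′ := χ₂ ∘ e₂⁻¹|_T′`
  have he₂' := transport_symm_val L v L' v' Φ e₂ he₂
  have hT : ∀ t' : ↥(unitaryGroupOfForm (conjLocal L' (IsCMField.complexConj L') v') (cmLocalForm L' 2 v')),
      t' ∈ torusU (conjLocal L' (IsCMField.complexConj L') v') (cmLocalForm L' 2 v') →
        e₂.symm t' ∈ torusU (conjLocal L (IsCMField.complexConj L) v) (cmLocalForm L 2 v) := fun t' ht' =>
    (transport_mem_torusU_iff L' v' L v Φ.symm e₂.symm he₂' t').2 ht'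
  let τ : ↥(torusU (conjLocal L' (IsCMField.complexConj L') v') (cmLocalForm L' 2 v')) →* ↥(torusU (conjLocal L (IsCMField.complexConj L) v) (cmLocalForm L 2 v)) :=
    { toFun := fun t' => ⟨e₂.symm (t' : ↥(unitaryGroupOfForm (conjLocal L' (IsCMField.complexConj L') v') (cmLocalForm L' 2 v'))), hT _ t'.2⟩
      map_one' := Subtype.ext (map_one e₂.symm)
      map_mul' := fun a b => Subtype.ext (map_mul e₂.symm _ _) }
  have hτ : ∀ (t : ↥(torusU (conjLocal L (IsCMField.complexConj L) v) (cmLocalForm L 2 v)))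
      (ht : e₂ (t : ↥(unitaryGroupOfForm (conjLocal L (IsCMField.complexConj L) v) (cmLocalForm L 2 v))) ∈
        torusU (conjLocal L' (IsCMField.complexConj L') v') (cmLocalForm L' 2 v')),
      (χ₂.comp τ) ⟨e₂ (t : ↥(unitaryGroupOfForm (conjLocal L (IsCMField.complexConj L) v) (cmLocalForm L 2 v))), ht⟩ = χ₂ t := by
    intro t ht
    show χ₂ (τ ⟨e₂ (t : ↥(unitaryGroupOfForm (conjLocal L (IsCMField.complexConj L) v) (cmLocalForm L 2 v))), ht⟩) = χ₂ t
    congr 1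
    exact Subtype.ext (e₂.symm_apply_apply _)
  have hχ₁' : ∀ g, (χ₁.comp (e₁.symm : (UnitaryGroup.cmDatum L' 1 (Matrix.of fun i j : Fin 1 => if i.val + j.val + 1 = 1 then (1 : L') else 0)).Local v' →* (UnitaryGroup.cmDatum L 1 (Matrix.of fun i j : Fin 1 => if i.val + j.val + 1 = 1 then (1 : L) else 0)).Local v)) (e₁ g) = χ₁ g := fun g => by
    change χ₁ (e₁.symm (e₁ g)) = χ₁ g; rw [ContinuousMulEquiv.symm_apply_apply]
  refine ⟨χ₂.comp τ, χ₁.comp (e₁.symm : (UnitaryGroup.cmDatum L' 1 (Matrix.of fun i j : Fin 1 => if i.val + j.val + 1 = 1 then (1 : L') else 0)).Local v' →* (UnitaryGroup.cmDatum L 1 (Matrix.of fun i j : Fin 1 => if i.val + j.val + 1 = 1 then (1 : L) else 0)).Local v), isOpen_ker_comp_symm e₁ χ₁ hχ₁, ?_, ?_⟩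
  · exact isIrreducible_cmPrincipalSeriesH_transport L v L' v' Φ e₂ he₂ e₁ eH heH χ₂ (χ₂.comp τ) hτ χ₁ _ hχ₁' hirr
  · exact (comap_symm_isConstituentOf_cmPrincipalSeriesH_iff L v L' v' Φ e₂ he₂ e₁ eH heH χ₂ (χ₂.comp τ) hτ χ₁ _ hχ₁' σ).2 hσ

end Bricks

end Summit.HodgeConjecture.HodgeConjecture.R90.S3

end
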